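import Literature.MathematicalPhysics.QuantumFieldTheory.Balaban1983to89.B9Eq326ConjugatedDeltaATowerTwoBackgroundsFirstOrder
import Literature.MathematicalPhysics.QuantumFieldTheory.Balaban1983to89.B9Eq326DeltaABlockDecayTower

/-!
# `Balaban1983to89.B9Eq326DeltaABlockDecayTowerTwoBackgrounds` — T. Bałaban, *Propagators for lattice gauge theories in a background field*, Commun. Math.
# Phys. **99** (1985) 389–434 [Balaban1985BackgroundPropagators] (3.26) p. 395, (3.49) p. 399, Thm 3.4 p. 400, (3.70)–(3.73) pp. 404–405, (3.86) p. 407, Thm 3.11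
# p. 416 with [Balaban1985Variational] (110) p. 294: **THE BIG-BLOCK `L²` DECAY OF THE TWO-BACKGROUND DIFFERENCE `G₁,k(V) − G₁,k(U)` OF THE TOWER BOND
# PROPAGATOR, EVERY HEIGHT — `‖P_{y₁} ∘ (G₁,k(V) − G₁,k(U)) ∘ P_{y₀}‖ ≤ C(δ)·e^{r}·e^{−r·d_m(y₀,y₁)}` with `C(δ)` LINEAR in the bond closeness `δ` at leading
# order and NO `η`, NO volume** — t4-ne9-idea-1 g151's N52 road (α) END read out through ne9-leaf-03's circle read-out: the two-background twin of ne9-leaf-03's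
# (GBDT) `B9Eq326DeltaABlockDecayTower.norm_block_G1k_le` (`‖P_{y₁}∘G₁,k(U)∘P_{y₀}‖ ≤ (4∕γ)e^{r}e^{−rd}`), with this lineage's first-order END
# `B9Eq326ConjugatedDeltaATowerTwoBackgroundsFirstOrder.norm_conjG1k_sub_conjG1k_le_firstOrder` in place of (CDT); the conjugated `R_k` ∕ `Q_k` ∕ `Δ′`
# two-background letters and the `R_k` ∕ `Q_k` Lipschitz letters stay displayed

statement-level skeleton of published theorems with citation tags; proofs where landed; nothing here is a claim about the Yang–Mills mass gap

CITATION HEADER (lean-in-tree rule).  Audit cell `pub-balaban`, sub-cell `t4`, BINDER row NE9; filed by NE9 formalisation-swarm LEAF PROVER 01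
(`b2b-balaban-t4-ne9-formalise-leaf-01`, gen 88) under the fallback offer O-leaf01-g88-2 (the read-out, «NOT claimed» by ne9-leaf-04 g81, cell journal 2026-08-25
l.63833).  Imports this lineage's `…TowerTwoBackgroundsFirstOrder` and ne9-leaf-03's `B9Eq326DeltaABlockDecayTower` (for its imports and proof TEXT: §1∕§2 below are
(GBDT)'s §1∕§2 with the background doubled — CREDIT ne9-leaf-03 g76; `equiv_exp_smul_apply_complex`, `apply_inv_apply'`, `exists_pointwise_clm`,
`norm_bondBlock_le_exp_of_uniform_circle_bound_cast` BY NAME).  Sources READ first-hand in the held text layer (`paper:balaban1985-cmp99-background-propagators`,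
journal page = PDF page + 388): p. 395 (3.26), p. 399 (3.49), p. 400 Thm 3.4 and (3.52)–(3.53), pp. 404–405 (3.70)–(3.73), p. 407 (3.86), p. 416 Thm 3.11.  Print's
two-background statement is the analytic perturbation (3.86) and its decay proof the random walk of Sect. C; the conjugation is the ROUTE's Combes–Thomas
substitute (`t4/ROUTES-NE9.md` §L1.2 R2′ road B8″, §L1.4 N52); nothing of print's rate or radius is asserted.

WHAT IS PROVED (sorry-free; proof lane — no `def`; [folklore] composition BY NAME).
* §1 **`norm_conjG1k_sub_conjG1k_le_of_circle`** — at one `κ` of the circle `‖κ‖ = r`: `‖exp(κ•M_B) ∘ (G₁,k(V) − G₁,k(U)) ∘ exp(−κ•M_B)‖ ≤ C(δ)` from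
  `…FirstOrder` at the operator exponentials of the multipliers (`Q_κ(X) := e^{κM_F}Q_k(X)e^{−κM_B}`, `Q′_κ(X) := e^{κM_B}Q_k(X)†e^{−κM_F}`), the (CDT)
  letters `dQ, dQ′, dK, dR` AT BOTH BACKGROUNDS, the conjugated two-background sockets `δ_R, δ_Q, δ_K` and `e_R, e_Q` displayed at this `κ`.
* §2 **`norm_block_G1k_sub_G1k_le`** — the display above, the letters quantified uniformly over the weights with bond increments `≤ ℓη`, the companions
  `|χ′(y) − χ(x)| ≤ ℓ′` and the circle `‖κ‖ = r` (two `hQK`-type bundles + one two-background bundle).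
MODEL ∕ HONEST SCOPE.  As (GBDT) and `…FirstOrder`: every Thm-3.11-currency letter displayed twice; `δ_R` (`R_k`, non-local), `δ_Q` (`Q_k`), `δ_K` (`Δ′`;
ne9-leaf-04 g81's announced letter), `e_R`, `e_Q` displayed uniformly; `C(δ)` crude and NOT simplified; first order; no rate, window or number evaluated.  NOT NE9
(cell pub-balaban: NE9 NOT PRINTED ∕ NOT PROVED; «NE9 ⇐ the named binders»; row WALLED ON A MODEL (O-NE9-1; #5 UNRULED); spine PROVED 0∕9; rung (B)+1 on a finite
T⁴ — NOT infinite volume, NOT mass gap, NOT BetaPertH, NOT Clay).  HONEST DEPENDENCY (cell line): continuum YM on T⁴ ⇐ BetaPertH ∧ nine spine estimates (0/9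
proved); BetaPertH ⇐ (D1) ∧ (D4) ∧ CAP+tail; G-an2-4 gates asym, D1 and NE2/3/4.  NEW file; nothing modified.  Net new unproved facts: 0.
-/

noncomputable section

open scoped InnerProductSpace ComplexConjugate BigOperators
open NormedSpace

namespace Literature.MathematicalPhysics.QuantumFieldTheory.Balaban1983to89.B9Eq326DeltaABlockDecayTowerTwoBackgrounds

open B4Sect5Torus (TSite tdist)
open B9SectCLatticeCarrier (Bond bpos btgt)
open B9Eq311L2Pairing (WL2)
open B9Eq319QprimeTorus (blockCoord)
open B9Eq315QTower (towerP)
open B9Eq315QTorus (perCfg cornerSite)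
open B7Prop1Explicit (Wcx boxVec)
open B9Eq316TowerFlatIsOneStep (siteCast siteCast_rfl towerP_eq_fineP_pow)
open B7Prop1Explicit (U1)
open B11Eq103H1Complex (SiteL2K BondL2K covDivL2K)
open B9Eq310HessianOperator (adTransportW PlaqL2K curvOp)
open B9Eq326OperatorTower (laplaceAk RofUk G1k QkW)
open B9Eq326ConjugatedDeltaATower (apply_inv_apply')
open B9Eq326ConjugatedDeltaATowerTwoBackgroundsFirstOrder (norm_conjG1k_sub_conjG1k_le_firstOrder)
open B9Eq349BondBlockDecayFromCircle (norm_bondBlock_le_exp_of_uniform_circle_bound_cast)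
open B9Eq3101ExpPointwiseMultiplier (equiv_exp_smul_apply_complex equiv_exp_smul_neg_apply_complex)
open B9Eq387IMSLocalLettersLattice (exists_pointwise_clm)

/-! ## §1 The circle form of the conjugated two-background bound -/

section Circle

variable {d : ℕ} (L : ℕ) [NeZero L] (m : Fin d → ℕ) [∀ i, NeZero (m i)] (n : ℕ)
  {𝔸 : Type*} [NormedRing 𝔸] [StarRing 𝔸] [NormedAlgebra ℂ 𝔸] [StarModule ℂ 𝔸] [CompleteSpace 𝔸] [NormOneClass 𝔸]
  {W : Type*} [NormedAddCommGroup W] [InnerProductSpace ℂ W] [FiniteDimensional ℂ W] (φ : W ≃ₗ[ℂ] 𝔸) {Mφ Mφ' : ℝ}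
  (hφ : ∀ w, ‖φ w‖ ≤ Mφ * ‖w‖) (hφ' : ∀ X, ‖φ.symm X‖ ≤ Mφ' * ‖X‖) (hMφ : 0 ≤ Mφ) (hMφ' : 0 ≤ Mφ')
  {c₀ : ℝ} [Fact (0 < c₀)] {c₁ : ℝ} [Fact (0 < c₁)] {η : ℝ} (hη : 0 < η) (U V : Bond d (towerP L m (n + 1)) → 𝔸ˣ) (hU : ∀ b, U b ∈ U1 𝔸) (hV : ∀ b, V b ∈ U1 𝔸)
  (hRSU : ∀ (b : Bond d (towerP L m (n + 1))) (v u : W), ⟪adTransportW φ U b v, u⟫_ℂ = ⟪v, adTransportW φ (fun b => (U b)⁻¹) b u⟫_ℂ)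
  (hRSV : ∀ (b : Bond d (towerP L m (n + 1))) (v u : W), ⟪adTransportW φ V b v, u⟫_ℂ = ⟪v, adTransportW φ (fun b => (V b)⁻¹) b u⟫_ℂ)
  (τ : 𝔸 →ₗ[ℂ] ℂ) (hL : 1 ≤ L) (α : ℕ → ℝ) (hα1 : ∀ j, α j ≤ 1 / 64)
  (hU1U : ∀ (j : ℕ) (x : B7Prop1Explicit.Site d) (κ : Fin d), perCfg (towerP L m (j + 1)) (B9Eq315QTower.UlevOf L m (n + 1) U j) x κ ∈ U1 𝔸)
  (hregU : ∀ (j : ℕ) (y : TSite d (towerP L m j)) (κ : Fin d) (r : Fin d → Fin L),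
    ‖((Wcx L (perCfg (towerP L m (j + 1)) (B9Eq315QTower.UlevOf L m (n + 1) U j)) (cornerSite L y) κ (boxVec L r) : 𝔸ˣ) : 𝔸) - 1‖ ≤ α j)
  (hU1V : ∀ (j : ℕ) (x : B7Prop1Explicit.Site d) (κ : Fin d), perCfg (towerP L m (j + 1)) (B9Eq315QTower.UlevOf L m (n + 1) V j) x κ ∈ U1 𝔸)
  (hregV : ∀ (j : ℕ) (y : TSite d (towerP L m j)) (κ : Fin d) (r : Fin d → Fin L),
    ‖((Wcx L (perCfg (towerP L m (j + 1)) (B9Eq315QTower.UlevOf L m (n + 1) V j)) (cornerSite L y) κ (boxVec L r) : 𝔸ˣ) : 𝔸) - 1‖ ≤ α j)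
  (a : ℝ) {χ : TSite d (towerP L m (n + 1)) → ℝ} {χ' : TSite d m → ℝ}
  {MB : BondL2K ℂ d (towerP L m (n + 1)) c₀ W →L[ℂ] BondL2K ℂ d (towerP L m (n + 1)) c₀ W}
  (hMB : ∀ (g : BondL2K ℂ d (towerP L m (n + 1)) c₀ W) (b : Bond d (towerP L m (n + 1))),
    WL2.equiv ℂ (fun _ : Bond d (towerP L m (n + 1)) => c₀) W (MB g) b = (χ (bpos b) : ℂ) • WL2.equiv ℂ (fun _ : Bond d (towerP L m (n + 1)) => c₀) W g b)
  {MP : PlaqL2K ℂ d (towerP L m (n + 1)) c₀ W →L[ℂ] PlaqL2K ℂ d (towerP L m (n + 1)) c₀ W}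
  (hMP : ∀ (g : PlaqL2K ℂ d (towerP L m (n + 1)) c₀ W) (p : B9SectCLatticeCarrier.Plaq d (towerP L m (n + 1))),
    WL2.equiv ℂ (fun _ : B9SectCLatticeCarrier.Plaq d (towerP L m (n + 1)) => c₀) W (MP g) p =
      (χ p.1 : ℂ) • WL2.equiv ℂ (fun _ : B9SectCLatticeCarrier.Plaq d (towerP L m (n + 1)) => c₀) W g p)
  {MS : SiteL2K ℂ d (towerP L m (n + 1)) c₀ W →L[ℂ] SiteL2K ℂ d (towerP L m (n + 1)) c₀ W}
  (hMS : ∀ (g : SiteL2K ℂ d (towerP L m (n + 1)) c₀ W) (x : TSite d (towerP L m (n + 1))),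
    WL2.equiv ℂ (fun _ : TSite d (towerP L m (n + 1)) => c₀) W (MS g) x = (χ x : ℂ) • WL2.equiv ℂ (fun _ : TSite d (towerP L m (n + 1)) => c₀) W g x)
  {MF : BondL2K ℂ d m c₁ W →L[ℂ] BondL2K ℂ d m c₁ W}
  (hMF : ∀ (g : BondL2K ℂ d m c₁ W) (b' : Bond d m),
    WL2.equiv ℂ (fun _ : Bond d m => c₁) W (MF g) b' = (χ' (bpos b') : ℂ) • WL2.equiv ℂ (fun _ : Bond d m => c₁) W g b')

-- the ninety-binder composition exceeds the default elaboration budget (two (CDT) letter lists + the END); the proof itself is three `have`s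
set_option maxHeartbeats 800000 in
include hφ hφ' hMφ hMφ' hη hU hV hRSU hRSV hMB hMP hMS hMF in
/-- **THE CONJUGATED TWO-BACKGROUND DIFFERENCE AT ONE `κ` OF THE CIRCLE `‖κ‖ = r`**: `‖exp(κ•M_B) ∘ (G₁,k(V) − G₁,k(U)) ∘ exp(−κ•M_B)‖ ≤ C(δ)` —
`…FirstOrder.norm_conjG1k_sub_conjG1k_le_firstOrder` at the operator exponentials of the multipliers (as (GBDT) §1 does for one background), the (CDT) letters
`dQ, dQ′, dK, dR` AT `U` AND AT `V`, the conjugated two-background sockets `δ_R`, `δ_Q`, `δ_K` and the Lipschitz letters `e_R`, `e_Q` displayed at this `κ`,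
the bond closeness `‖U(b) − V(b)‖ ≤ δη`. [folklore] [cite: Balaban1985BackgroundPropagators, (3.26) p.395, (3.49) p.399, Thm 3.4 p.400, (3.86) p.407, Thm 3.11 p.416] -/
theorem norm_conjG1k_sub_conjG1k_le_of_circle (ha : 0 ≤ a)
    (hposU : ∀ x : BondL2K ℂ d (towerP L m (n + 1)) c₀ W, x ≠ 0 → 0 < RCLike.re ⟪x, laplaceAk L m n φ η U hL α hα1 hU1U hregU τ (c₀ := c₀) (c₁ := c₁) a x⟫_ℂ)
    (hposV : ∀ x : BondL2K ℂ d (towerP L m (n + 1)) c₀ W, x ≠ 0 → 0 < RCLike.re ⟪x, laplaceAk L m n φ η V hL α hα1 hU1V hregV τ (c₀ := c₀) (c₁ := c₁) a x⟫_ℂ)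
    {γ β βK pK ℓ r ρ CP : ℝ} (hγ : 0 < γ) (hβ : 0 ≤ β) (hℓ : 0 ≤ ℓ) (hρ : 0 ≤ ρ) (hρ8 : ρ ≤ 1 / 8) (hCP : 0 ≤ CP)
    (hcoerU : ∀ f : BondL2K ℂ d (towerP L m (n + 1)) c₀ W, γ * ‖f‖ ^ 2 ≤ RCLike.re ⟪f, laplaceAk L m n φ η U hL α hα1 hU1U hregU τ (c₀ := c₀) (c₁ := c₁) a f⟫_ℂ)
    (hcoerV : ∀ f : BondL2K ℂ d (towerP L m (n + 1)) c₀ W, γ * ‖f‖ ^ 2 ≤ RCLike.re ⟪f, laplaceAk L m n φ η V hL α hα1 hU1V hregV τ (c₀ := c₀) (c₁ := c₁) a f⟫_ℂ)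
    (hKreU : ∀ f : BondL2K ℂ d (towerP L m (n + 1)) c₀ W, -(pK * ‖f‖ ^ 2) ≤ RCLike.re ⟪f, curvOp φ τ η U f⟫_ℂ)
    (hKreV : ∀ f : BondL2K ℂ d (towerP L m (n + 1)) c₀ W, -(pK * ‖f‖ ^ 2) ≤ RCLike.re ⟪f, curvOp φ τ η V f⟫_ℂ)
    (hχ : ∀ b : Bond d (towerP L m (n + 1)), |χ (bpos b) - χ (btgt b)| ≤ ℓ * η) (hwin : r * ℓ * η ≤ 1)
    (hβCC : 4 * r * ℓ * (Mφ * Mφ') * (d * Real.sqrt d) ≤ β) (hβC : 4 * r * ℓ * (Mφ * Mφ') * d ≤ β)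
    (hβD : 2 * r * ℓ * (Mφ * Mφ') * Real.sqrt d ≤ β)
    (hPU : ∀ f, ‖covDivL2K ℂ c₀ ((η : ℂ))⁻¹ (adTransportW φ fun b => (U b)⁻¹) f - RofUk L m n φ η U (c₀ := c₀) (covDivL2K ℂ c₀ ((η : ℂ))⁻¹ (adTransportW φ fun b => (U b)⁻¹) f)‖ ≤ CP * ‖f‖)
    (hPV : ∀ f, ‖covDivL2K ℂ c₀ ((η : ℂ))⁻¹ (adTransportW φ fun b => (V b)⁻¹) f - RofUk L m n φ η V (c₀ := c₀) (covDivL2K ℂ c₀ ((η : ℂ))⁻¹ (adTransportW φ fun b => (V b)⁻¹) f)‖ ≤ CP * ‖f‖)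
    (small' : 3 / 4 * pK + (21 + 3 * a) * β ^ 2 + 4 * β * CP + 2 * ρ * CP ^ 2 + βK ≤ γ / 8) (κ : ℂ) (hκr : ‖κ‖ = r)
    (dQU : ∀ f, ‖exp (κ • MF) ((QkW L m n φ U hL α hα1 hU1U hregU (c₀ := c₀) (c₁ := c₁)) (exp (κ • (-MB)) f)) - (QkW L m n φ U hL α hα1 hU1U hregU (c₀ := c₀) (c₁ := c₁)) f‖ ≤ β * ‖f‖)
    (dQU' : ∀ g, ‖exp (κ • MB) (LinearMap.adjoint (QkW L m n φ U hL α hα1 hU1U hregU (c₀ := c₀) (c₁ := c₁)) (exp (κ • (-MF)) g)) - LinearMap.adjoint (QkW L m n φ U hL α hα1 hU1U hregU (c₀ := c₀) (c₁ := c₁)) g‖ ≤ β * ‖g‖)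
    (dKU : ∀ f, ‖exp (κ • MB) (curvOp φ τ η U (exp (κ • (-MB)) f)) - curvOp φ τ η U f‖ ≤ βK * ‖f‖)
    (dRU : ∀ s, ‖exp (κ • MS) (RofUk L m n φ η U (c₀ := c₀) (exp (κ • (-MS)) s)) - RofUk L m n φ η U (c₀ := c₀) s‖ ≤ ρ * ‖s‖)
    (dQV : ∀ f, ‖exp (κ • MF) ((QkW L m n φ V hL α hα1 hU1V hregV (c₀ := c₀) (c₁ := c₁)) (exp (κ • (-MB)) f)) - (QkW L m n φ V hL α hα1 hU1V hregV (c₀ := c₀) (c₁ := c₁)) f‖ ≤ β * ‖f‖)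
    (dQV' : ∀ g, ‖exp (κ • MB) (LinearMap.adjoint (QkW L m n φ V hL α hα1 hU1V hregV (c₀ := c₀) (c₁ := c₁)) (exp (κ • (-MF)) g)) - LinearMap.adjoint (QkW L m n φ V hL α hα1 hU1V hregV (c₀ := c₀) (c₁ := c₁)) g‖ ≤ β * ‖g‖)
    (dKV : ∀ f, ‖exp (κ • MB) (curvOp φ τ η V (exp (κ • (-MB)) f)) - curvOp φ τ η V f‖ ≤ βK * ‖f‖)
    (dRV : ∀ s, ‖exp (κ • MS) (RofUk L m n φ η V (c₀ := c₀) (exp (κ • (-MS)) s)) - RofUk L m n φ η V (c₀ := c₀) s‖ ≤ ρ * ‖s‖)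
    -- the conjugated two-background sockets at this `κ`
    {δR δQ δK : ℝ} (hδR : 0 ≤ δR) (hδQ : 0 ≤ δQ) (hδK : 0 ≤ δK)
    (tR : ∀ s, ‖exp (κ • MS) (RofUk L m n φ η V (c₀ := c₀) (exp (κ • (-MS)) s)) - exp (κ • MS) (RofUk L m n φ η U (c₀ := c₀) (exp (κ • (-MS)) s))‖ ≤ δR * ‖s‖)
    (tQ : ∀ f, ‖exp (κ • MF) ((QkW L m n φ V hL α hα1 hU1V hregV (c₀ := c₀) (c₁ := c₁)) (exp (κ • (-MB)) f)) - exp (κ • MF) ((QkW L m n φ U hL α hα1 hU1U hregU (c₀ := c₀) (c₁ := c₁)) (exp (κ • (-MB)) f))‖ ≤ δQ * ‖f‖)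
    (tQ' : ∀ g, ‖exp (κ • MB) (LinearMap.adjoint (QkW L m n φ V hL α hα1 hU1V hregV (c₀ := c₀) (c₁ := c₁)) (exp (κ • (-MF)) g)) - exp (κ • MB) (LinearMap.adjoint (QkW L m n φ U hL α hα1 hU1U hregU (c₀ := c₀) (c₁ := c₁)) (exp (κ • (-MF)) g))‖ ≤ δQ * ‖g‖)
    (tK : ∀ f, ‖exp (κ • MB) (curvOp φ τ η V (exp (κ • (-MB)) f)) - exp (κ • MB) (curvOp φ τ η U (exp (κ • (-MB)) f))‖ ≤ δK * ‖f‖)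
    -- the bond closeness and the two Lipschitz letters
    {δ eR eQ : ℝ} (hδ : 0 ≤ δ) (heR : 0 ≤ eR) (heQ : 0 ≤ eQ) (hUV : ∀ b, ‖(U b : 𝔸) - (V b : 𝔸)‖ ≤ δ * η)
    (uR : ∀ s, ‖RofUk L m n φ η U (c₀ := c₀) s - RofUk L m n φ η V (c₀ := c₀) s‖ ≤ eR * ‖s‖) (uQ : ∀ f, ‖(QkW L m n φ U hL α hα1 hU1U hregU (c₀ := c₀) (c₁ := c₁)) f - (QkW L m n φ V hL α hα1 hU1V hregV (c₀ := c₀) (c₁ := c₁)) f‖ ≤ eQ * ‖f‖) :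
    ‖exp (κ • MB) ∘L (LinearMap.toContinuousLinearMap (G1k L m n φ η V hL α hα1 hU1V hregV τ (c₀ := c₀) (c₁ := c₁) hposV) - LinearMap.toContinuousLinearMap (G1k L m n φ η U hL α hα1 hU1U hregU τ (c₀ := c₀) (c₁ := c₁) hposU)) ∘L exp (κ • (-MB))‖ ≤
      (((1 + β) * (4 * Real.exp (r * (ℓ * η)) * (Mφ * Mφ') * (d * Real.sqrt d) * δ) + (4 * Real.exp (r * (ℓ * η)) * (Mφ * Mφ') * (d * Real.sqrt d) * δ) * (1 + β) + (4 * Real.exp (r * (ℓ * η)) * (Mφ * Mφ') * (d * Real.sqrt d) * δ) * (4 * Real.exp (r * (ℓ * η)) * (Mφ * Mφ') * (d * Real.sqrt d) * δ)) +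
          ((1 + CP + β) * ((1 + ρ) * (2 * Real.exp (r * (ℓ * η)) * (Mφ * Mφ') * Real.sqrt d * δ) + δR * (1 + CP + β)) + (2 * Real.exp (r * (ℓ * η)) * (Mφ * Mφ') * Real.sqrt d * δ) * ((1 + ρ) * (1 + CP + β)) +
            (2 * Real.exp (r * (ℓ * η)) * (Mφ * Mφ') * Real.sqrt d * δ) * ((1 + ρ) * (2 * Real.exp (r * (ℓ * η)) * (Mφ * Mφ') * Real.sqrt d * δ) + δR * (1 + CP + β))) +
          δK + ((Real.sqrt a + |a| * β) * δQ + δQ * (Real.sqrt a + |a| * β) + |a| * (δQ * δQ))) / min (1 / 4) (γ / 8) *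
        ((1 + (8 * Real.sqrt d * (Mφ * Mφ') * δ + 2 * Mφ * Mφ' * δ * Real.sqrt d + eR * (1 + CP) + Real.sqrt a * eQ)) * (min (1 / 4) (γ / 8))⁻¹) := by
  -- nonnegativity of the constant, with the radius factor, `min` and the two first-order letters as atoms (keeps `positivity` cheap)
  have hm₀ : 0 < min (1 / 4 : ℝ) (γ / 8) := lt_min (by norm_num) (by linarith)
  have hC0 : 0 ≤ (((1 + β) * (4 * Real.exp (r * (ℓ * η)) * (Mφ * Mφ') * (d * Real.sqrt d) * δ) + (4 * Real.exp (r * (ℓ * η)) * (Mφ * Mφ') * (d * Real.sqrt d) * δ) * (1 + β) + (4 * Real.exp (r * (ℓ * η)) * (Mφ * Mφ') * (d * Real.sqrt d) * δ) * (4 * Real.exp (r * (ℓ * η)) * (Mφ * Mφ') * (d * Real.sqrt d) * δ)) +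
          ((1 + CP + β) * ((1 + ρ) * (2 * Real.exp (r * (ℓ * η)) * (Mφ * Mφ') * Real.sqrt d * δ) + δR * (1 + CP + β)) + (2 * Real.exp (r * (ℓ * η)) * (Mφ * Mφ') * Real.sqrt d * δ) * ((1 + ρ) * (1 + CP + β)) +
            (2 * Real.exp (r * (ℓ * η)) * (Mφ * Mφ') * Real.sqrt d * δ) * ((1 + ρ) * (2 * Real.exp (r * (ℓ * η)) * (Mφ * Mφ') * Real.sqrt d * δ) + δR * (1 + CP + β))) +
          δK + ((Real.sqrt a + |a| * β) * δQ + δQ * (Real.sqrt a + |a| * β) + |a| * (δQ * δQ))) / min (1 / 4) (γ / 8) *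
        ((1 + (8 * Real.sqrt d * (Mφ * Mφ') * δ + 2 * Mφ * Mφ' * δ * Real.sqrt d + eR * (1 + CP) + Real.sqrt a * eQ)) * (min (1 / 4) (γ / 8))⁻¹) := by
    generalize hE : Real.exp (r * (ℓ * η)) = E
    generalize hm : min (1 / 4 : ℝ) (γ / 8) = m₀
    have hE0 : 0 ≤ E := hE ▸ (Real.exp_pos _).le
    have hm0 : 0 < m₀ := hm ▸ hm₀
    positivity
  refine ContinuousLinearMap.opNorm_le_bound _ hC0 fun v => ?_
  -- the six multipliers at this `κ`, as linear maps with their pointwise actions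
  have hS : ∀ (g : BondL2K ℂ d (towerP L m (n + 1)) c₀ W) (b : Bond d (towerP L m (n + 1))),
      WL2.equiv ℂ (fun _ : Bond d (towerP L m (n + 1)) => c₀) W
          (((exp (κ • MB) : BondL2K ℂ d (towerP L m (n + 1)) c₀ W →L[ℂ] BondL2K ℂ d (towerP L m (n + 1)) c₀ W) :
            BondL2K ℂ d (towerP L m (n + 1)) c₀ W →ₗ[ℂ] BondL2K ℂ d (towerP L m (n + 1)) c₀ W) g) b =
        Complex.exp (κ * (χ (bpos b) : ℂ)) • WL2.equiv ℂ (fun _ : Bond d (towerP L m (n + 1)) => c₀) W g b :=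
    fun g b => equiv_exp_smul_apply_complex MB (fun b => χ (bpos b)) hMB κ g b
  have hSinv : ∀ (g : BondL2K ℂ d (towerP L m (n + 1)) c₀ W) (b : Bond d (towerP L m (n + 1))),
      WL2.equiv ℂ (fun _ : Bond d (towerP L m (n + 1)) => c₀) W
          (((exp (κ • (-MB)) : BondL2K ℂ d (towerP L m (n + 1)) c₀ W →L[ℂ] BondL2K ℂ d (towerP L m (n + 1)) c₀ W) :
            BondL2K ℂ d (towerP L m (n + 1)) c₀ W →ₗ[ℂ] BondL2K ℂ d (towerP L m (n + 1)) c₀ W) g) b =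
        Complex.exp (-(κ * (χ (bpos b) : ℂ))) • WL2.equiv ℂ (fun _ : Bond d (towerP L m (n + 1)) => c₀) W g b :=
    fun g b => equiv_exp_smul_neg_apply_complex MB (fun b => χ (bpos b)) hMB κ g b
  have hSP : ∀ (g : PlaqL2K ℂ d (towerP L m (n + 1)) c₀ W) (p : B9SectCLatticeCarrier.Plaq d (towerP L m (n + 1))),
      WL2.equiv ℂ (fun _ : B9SectCLatticeCarrier.Plaq d (towerP L m (n + 1)) => c₀) W
          (((exp (κ • MP) : PlaqL2K ℂ d (towerP L m (n + 1)) c₀ W →L[ℂ] PlaqL2K ℂ d (towerP L m (n + 1)) c₀ W) :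
            PlaqL2K ℂ d (towerP L m (n + 1)) c₀ W →ₗ[ℂ] PlaqL2K ℂ d (towerP L m (n + 1)) c₀ W) g) p =
        Complex.exp (κ * (χ p.1 : ℂ)) • WL2.equiv ℂ (fun _ : B9SectCLatticeCarrier.Plaq d (towerP L m (n + 1)) => c₀) W g p :=
    fun g p => equiv_exp_smul_apply_complex MP (fun p : B9SectCLatticeCarrier.Plaq d (towerP L m (n + 1)) => χ p.1) hMP κ g p
  have hSPinv : ∀ (g : PlaqL2K ℂ d (towerP L m (n + 1)) c₀ W) (p : B9SectCLatticeCarrier.Plaq d (towerP L m (n + 1))),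
      WL2.equiv ℂ (fun _ : B9SectCLatticeCarrier.Plaq d (towerP L m (n + 1)) => c₀) W
          (((exp (κ • (-MP)) : PlaqL2K ℂ d (towerP L m (n + 1)) c₀ W →L[ℂ] PlaqL2K ℂ d (towerP L m (n + 1)) c₀ W) :
            PlaqL2K ℂ d (towerP L m (n + 1)) c₀ W →ₗ[ℂ] PlaqL2K ℂ d (towerP L m (n + 1)) c₀ W) g) p =
        Complex.exp (-(κ * (χ p.1 : ℂ))) • WL2.equiv ℂ (fun _ : B9SectCLatticeCarrier.Plaq d (towerP L m (n + 1)) => c₀) W g p :=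
    fun g p => equiv_exp_smul_neg_apply_complex MP (fun p : B9SectCLatticeCarrier.Plaq d (towerP L m (n + 1)) => χ p.1) hMP κ g p
  have hSS : ∀ (g : SiteL2K ℂ d (towerP L m (n + 1)) c₀ W) (x : TSite d (towerP L m (n + 1))),
      WL2.equiv ℂ (fun _ : TSite d (towerP L m (n + 1)) => c₀) W
          (((exp (κ • MS) : SiteL2K ℂ d (towerP L m (n + 1)) c₀ W →L[ℂ] SiteL2K ℂ d (towerP L m (n + 1)) c₀ W) :
            SiteL2K ℂ d (towerP L m (n + 1)) c₀ W →ₗ[ℂ] SiteL2K ℂ d (towerP L m (n + 1)) c₀ W) g) x =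
        Complex.exp (κ * (χ x : ℂ)) • WL2.equiv ℂ (fun _ : TSite d (towerP L m (n + 1)) => c₀) W g x :=
    fun g x => equiv_exp_smul_apply_complex MS χ hMS κ g x
  have hSSinv : ∀ (g : SiteL2K ℂ d (towerP L m (n + 1)) c₀ W) (x : TSite d (towerP L m (n + 1))),
      WL2.equiv ℂ (fun _ : TSite d (towerP L m (n + 1)) => c₀) W
          (((exp (κ • (-MS)) : SiteL2K ℂ d (towerP L m (n + 1)) c₀ W →L[ℂ] SiteL2K ℂ d (towerP L m (n + 1)) c₀ W) :
            SiteL2K ℂ d (towerP L m (n + 1)) c₀ W →ₗ[ℂ] SiteL2K ℂ d (towerP L m (n + 1)) c₀ W) g) x =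
        Complex.exp (-(κ * (χ x : ℂ))) • WL2.equiv ℂ (fun _ : TSite d (towerP L m (n + 1)) => c₀) W g x :=
    fun g x => equiv_exp_smul_neg_apply_complex MS χ hMS κ g x
  -- the windows and the displayed letters at this `κ`
  have hwinκ : ‖κ‖ * ℓ * η ≤ 1 := by rw [hκr]; exact hwin
  have hβCC' : 4 * ‖κ‖ * ℓ * (Mφ * Mφ') * (d * Real.sqrt d) ≤ β := by rw [hκr]; exact hβCC
  have hβC' : 4 * ‖κ‖ * ℓ * (Mφ * Mφ') * d ≤ β := by rw [hκr]; exact hβC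
  have hβD' : 2 * ‖κ‖ * ℓ * (Mφ * Mφ') * Real.sqrt d ≤ β := by rw [hκr]; exact hβD
  -- the coarse multipliers and the factorisation `e^{κM_B}Q_k†(a•Q_k)e^{−κM_B} = a•(e^{κM_B}Q_k†e^{−κM_F})((e^{κM_F}Q_ke^{−κM_B})·)`
  have hSF : ∀ (g : BondL2K ℂ d m c₁ W) (b' : Bond d m),
      WL2.equiv ℂ (fun _ : Bond d m => c₁) W
          (((exp (κ • MF) : BondL2K ℂ d m c₁ W →L[ℂ] BondL2K ℂ d m c₁ W) : BondL2K ℂ d m c₁ W →ₗ[ℂ] BondL2K ℂ d m c₁ W) g) b' =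
        Complex.exp (κ * (χ' (bpos b') : ℂ)) • WL2.equiv ℂ (fun _ : Bond d m => c₁) W g b' :=
    fun g b' => equiv_exp_smul_apply_complex MF (fun b' => χ' (bpos b')) hMF κ g b'
  have hSFinv : ∀ (g : BondL2K ℂ d m c₁ W) (b' : Bond d m),
      WL2.equiv ℂ (fun _ : Bond d m => c₁) W
          (((exp (κ • (-MF)) : BondL2K ℂ d m c₁ W →L[ℂ] BondL2K ℂ d m c₁ W) : BondL2K ℂ d m c₁ W →ₗ[ℂ] BondL2K ℂ d m c₁ W) g) b' =
        Complex.exp (-(κ * (χ' (bpos b') : ℂ))) • WL2.equiv ℂ (fun _ : Bond d m => c₁) W g b' :=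
    fun g b' => equiv_exp_smul_neg_apply_complex MF (fun b' => χ' (bpos b')) hMF κ g b'
  have hSFi := apply_inv_apply' κ (fun b' : Bond d m => χ' (bpos b')) hSF hSFinv

  -- the conjugated `Q_k` maps of the two backgrounds and their factorisations
  have hfacU : ∀ f, ((exp (κ • MB) : BondL2K ℂ d (towerP L m (n + 1)) c₀ W →L[ℂ] BondL2K ℂ d (towerP L m (n + 1)) c₀ W) : BondL2K ℂ d (towerP L m (n + 1)) c₀ W →ₗ[ℂ] BondL2K ℂ d (towerP L m (n + 1)) c₀ W) (LinearMap.adjoint (QkW L m n φ U hL α hα1 hU1U hregU (c₀ := c₀) (c₁ := c₁)) (((a : ℝ) : ℂ) • (QkW L m n φ U hL α hα1 hU1U hregU (c₀ := c₀) (c₁ := c₁)) (((exp (κ • (-MB)) : BondL2K ℂ d (towerP L m (n + 1)) c₀ W →L[ℂ] BondL2K ℂ d (towerP L m (n + 1)) c₀ W) : BondL2K ℂ d (towerP L m (n + 1)) c₀ W →ₗ[ℂ] BondL2K ℂ d (towerP L m (n + 1)) c₀ W) f))) =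
      ((a : ℝ) : ℂ) • (((exp (κ • MB) : BondL2K ℂ d (towerP L m (n + 1)) c₀ W →L[ℂ] BondL2K ℂ d (towerP L m (n + 1)) c₀ W) : BondL2K ℂ d (towerP L m (n + 1)) c₀ W →ₗ[ℂ] BondL2K ℂ d (towerP L m (n + 1)) c₀ W) ∘ₗ LinearMap.adjoint (QkW L m n φ U hL α hα1 hU1U hregU (c₀ := c₀) (c₁ := c₁)) ∘ₗ ((exp (κ • (-MF)) : BondL2K ℂ d m c₁ W →L[ℂ] BondL2K ℂ d m c₁ W) : BondL2K ℂ d m c₁ W →ₗ[ℂ] BondL2K ℂ d m c₁ W)) ((((exp (κ • MF) : BondL2K ℂ d m c₁ W →L[ℂ] BondL2K ℂ d m c₁ W) : BondL2K ℂ d m c₁ W →ₗ[ℂ] BondL2K ℂ d m c₁ W) ∘ₗ (QkW L m n φ U hL α hα1 hU1U hregU (c₀ := c₀) (c₁ := c₁)) ∘ₗ ((exp (κ • (-MB)) : BondL2K ℂ d (towerP L m (n + 1)) c₀ W →L[ℂ] BondL2K ℂ d (towerP L m (n + 1)) c₀ W) : BondL2K ℂ d (towerP L m (n + 1)) c₀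 W →ₗ[ℂ] BondL2K ℂ d (towerP L m (n + 1)) c₀ W)) f) := fun f => by
    have e := hSFi ((QkW L m n φ U hL α hα1 hU1U hregU (c₀ := c₀) (c₁ := c₁)) ((exp (κ • (-MB)) : BondL2K ℂ d (towerP L m (n + 1)) c₀ W →L[ℂ] BondL2K ℂ d (towerP L m (n + 1)) c₀ W) f))
    simp only [ContinuousLinearMap.coe_coe] at e
    simp only [LinearMap.comp_apply, ContinuousLinearMap.coe_coe, map_smul, e]
  have hfacV : ∀ f, ((exp (κ • MB) : BondL2K ℂ d (towerP L m (n + 1)) c₀ W →L[ℂ] BondL2K ℂ d (towerP L m (n + 1)) c₀ W) : BondL2K ℂ d (towerP L m (n + 1)) c₀ W →ₗ[ℂ] BondL2K ℂ d (towerP L m (n + 1)) c₀ W) (LinearMap.adjoint (QkW L m n φ V hL α hα1 hU1V hregV (c₀ := c₀) (c₁ := c₁)) (((a : ℝ) : ℂ) • (QkW L m n φ V hL α hα1 hU1V hregV (c₀ := c₀) (c₁ := c₁)) (((exp (κ • (-MB)) : BondL2K ℂ d (towerP L m (n + 1)) c₀ W →L[ℂ] BondL2K ℂ d (towerP L m (n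 + 1)) c₀ W) : BondL2K ℂ d (towerP L m (n + 1)) c₀ W →ₗ[ℂ] BondL2K ℂ d (towerP L m (n + 1)) c₀ W) f))) =
      ((a : ℝ) : ℂ) • (((exp (κ • MB) : BondL2K ℂ d (towerP L m (n + 1)) c₀ W →L[ℂ] BondL2K ℂ d (towerP L m (n + 1)) c₀ W) : BondL2K ℂ d (towerP L m (n + 1)) c₀ W →ₗ[ℂ] BondL2K ℂ d (towerP L m (n + 1)) c₀ W) ∘ₗ LinearMap.adjoint (QkW L m n φ V hL α hα1 hU1V hregV (c₀ := c₀) (c₁ := c₁)) ∘ₗ ((exp (κ • (-MF)) : BondL2K ℂ d m c₁ W →L[ℂ] BondL2K ℂ d m c₁ W) : BondL2K ℂ d m c₁ W →ₗ[ℂ] BondL2K ℂ d m c₁ W)) ((((exp (κ • MF) : BondL2K ℂ d m c₁ W →L[ℂ] BondL2K ℂ d m c₁ W) : BondL2K ℂ d m c₁ W →ₗ[ℂ] BondL2K ℂ d m c₁ W) ∘ₗ (QkW L m n φ V hL α hα1 hU1V hregV (c₀ := c₀) (c₁ := c₁)) ∘ₗ ((exp (κ • (-MB)) : BondL2K ℂ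 d (towerP L m (n + 1)) c₀ W →L[ℂ] BondL2K ℂ d (towerP L m (n + 1)) c₀ W) : BondL2K ℂ d (towerP L m (n + 1)) c₀ W →ₗ[ℂ] BondL2K ℂ d (towerP L m (n + 1)) c₀ W)) f) := fun f => by
    have e := hSFi ((QkW L m n φ V hL α hα1 hU1V hregV (c₀ := c₀) (c₁ := c₁)) ((exp (κ • (-MB)) : BondL2K ℂ d (towerP L m (n + 1)) c₀ W →L[ℂ] BondL2K ℂ d (towerP L m (n + 1)) c₀ W) f))
    simp only [ContinuousLinearMap.coe_coe] at e
    simp only [LinearMap.comp_apply, ContinuousLinearMap.coe_coe, map_smul, e]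
  have h := norm_conjG1k_sub_conjG1k_le_firstOrder L m n φ hφ hφ' hMφ hMφ' hη U V hU hV hRSU hRSV τ hL α hα1 hU1U hregU hU1V hregV a
    (S := ((exp (κ • MB) : BondL2K ℂ d (towerP L m (n + 1)) c₀ W →L[ℂ] BondL2K ℂ d (towerP L m (n + 1)) c₀ W) : BondL2K ℂ d (towerP L m (n + 1)) c₀ W →ₗ[ℂ] BondL2K ℂ d (towerP L m (n + 1)) c₀ W)) (Sinv := ((exp (κ • (-MB)) : BondL2K ℂ d (towerP L m (n + 1)) c₀ W →L[ℂ] BondL2K ℂ d (towerP L m (n + 1)) c₀ W) : BondL2K ℂ d (towerP L m (n + 1)) c₀ W →ₗ[ℂ] BondL2K ℂ d (towerP L m (n + 1)) c₀ W)) hS hSinv hSP hSPinv hSS hSSinv ha hposU hposV hγ hβ hℓ hρ hρ8 hCP hcoerU hcoerV hKreU hKreV hχ hwinκ hβCC' hβC' hβD'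
    (((exp (κ • MF) : BondL2K ℂ d m c₁ W →L[ℂ] BondL2K ℂ d m c₁ W) : BondL2K ℂ d m c₁ W →ₗ[ℂ] BondL2K ℂ d m c₁ W) ∘ₗ (QkW L m n φ U hL α hα1 hU1U hregU (c₀ := c₀) (c₁ := c₁)) ∘ₗ ((exp (κ • (-MB)) : BondL2K ℂ d (towerP L m (n + 1)) c₀ W →L[ℂ] BondL2K ℂ d (towerP L m (n + 1)) c₀ W) : BondL2K ℂ d (towerP L m (n + 1)) c₀ W →ₗ[ℂ] BondL2K ℂ d (towerP L m (n + 1)) c₀ W)) (((exp (κ • MF) : BondL2K ℂ d m c₁ W →L[ℂ] BondL2K ℂ d m c₁ W) : BondL2K ℂ d m c₁ W →ₗ[ℂ] BondL2K ℂ d m c₁ W) ∘ₗ (QkW L m n φ V hL α hα1 hU1V hregV (c₀ := c₀) (c₁ := c₁)) ∘ₗ ((exp (κ • (-MB)) : BondL2K ℂ d (towerP L m (n + 1)) c₀ W →L[ℂ] BondL2K ℂ d (towerP L m (n + 1)) c₀ W) : BondL2K ℂ d (towerP L m (n + 1)) c₀ W →ₗ[ℂ] BondL2K ℂ d (towerP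 L m (n + 1)) c₀ W))
    (((exp (κ • MB) : BondL2K ℂ d (towerP L m (n + 1)) c₀ W →L[ℂ] BondL2K ℂ d (towerP L m (n + 1)) c₀ W) : BondL2K ℂ d (towerP L m (n + 1)) c₀ W →ₗ[ℂ] BondL2K ℂ d (towerP L m (n + 1)) c₀ W) ∘ₗ LinearMap.adjoint (QkW L m n φ U hL α hα1 hU1U hregU (c₀ := c₀) (c₁ := c₁)) ∘ₗ ((exp (κ • (-MF)) : BondL2K ℂ d m c₁ W →L[ℂ] BondL2K ℂ d m c₁ W) : BondL2K ℂ d m c₁ W →ₗ[ℂ] BondL2K ℂ d m c₁ W)) (((exp (κ • MB) : BondL2K ℂ d (towerP L m (n + 1)) c₀ W →L[ℂ] BondL2K ℂ d (towerP L m (n + 1)) c₀ W) : BondL2K ℂ d (towerP L m (n + 1)) c₀ W →ₗ[ℂ] BondL2K ℂ d (towerP L m (n + 1)) c₀ W) ∘ₗ LinearMap.adjoint (QkW L m n φ V hL α hα1 hU1V hregV (c₀ := c₀) (c₁ := c₁)) ∘ₗ ((exp (κ • (-MF)) : BondL2K ℂ d m c₁ W →L[ℂ] BondL2K ℂ d m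 c₁ W) : BondL2K ℂ d m c₁ W →ₗ[ℂ] BondL2K ℂ d m c₁ W))
    hfacU hfacV
    dQU
    dQU'
    dQV
    dQV'
    dKU
    dKV
    dRU
    dRV hPU hPV small' hδR hδQ hδK
    tR
    tQ
    tQ'
    tK hδ heR heQ hUV uR uQ v
  rw [hκr] at h
  simpa only [ContinuousLinearMap.comp_apply, sub_apply, LinearMap.coe_toContinuousLinearMap', map_sub, LinearMap.comp_apply,
    ContinuousLinearMap.coe_coe] using h

end Circle

/-! ## §2 The instance: big-block decay of `G₁,k(V) − G₁,k(U)` on the tower, every height, letters with companion -/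

section Instance

variable {d : ℕ} {L : ℕ} [NeZero L] {m : Fin d → ℕ} [∀ i, NeZero (m i)] {n : ℕ}
  {𝔸 : Type*} [NormedRing 𝔸] [StarRing 𝔸] [NormedAlgebra ℂ 𝔸] [StarModule ℂ 𝔸] [CompleteSpace 𝔸] [NormOneClass 𝔸]
  {W : Type*} [NormedAddCommGroup W] [InnerProductSpace ℂ W] [FiniteDimensional ℂ W] (φ : W ≃ₗ[ℂ] 𝔸) {Mφ Mφ' : ℝ}
  (hφ : ∀ w, ‖φ w‖ ≤ Mφ * ‖w‖) (hφ' : ∀ X, ‖φ.symm X‖ ≤ Mφ' * ‖X‖) (hMφ : 0 ≤ Mφ) (hMφ' : 0 ≤ Mφ')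
  {c₀ : ℝ} [Fact (0 < c₀)] {c₁ : ℝ} [Fact (0 < c₁)] {η : ℝ} (hη : 0 < η) (hηL : η * (L : ℝ) ^ (n + 1) = 1)
  (U V : Bond d (towerP L m (n + 1)) → 𝔸ˣ) (hU : ∀ b, U b ∈ U1 𝔸) (hV : ∀ b, V b ∈ U1 𝔸)
  (hRSU : ∀ (b : Bond d (towerP L m (n + 1))) (v u : W), ⟪adTransportW φ U b v, u⟫_ℂ = ⟪v, adTransportW φ (fun b => (U b)⁻¹) b u⟫_ℂ)
  (hRSV : ∀ (b : Bond d (towerP L m (n + 1))) (v u : W), ⟪adTransportW φ V b v, u⟫_ℂ = ⟪v, adTransportW φ (fun b => (V b)⁻¹) b u⟫_ℂ)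
  (τ : 𝔸 →ₗ[ℂ] ℂ) (hL : 1 ≤ L) (α : ℕ → ℝ) (hα1 : ∀ j, α j ≤ 1 / 64)
  (hU1U : ∀ (j : ℕ) (x : B7Prop1Explicit.Site d) (κ : Fin d), perCfg (towerP L m (j + 1)) (B9Eq315QTower.UlevOf L m (n + 1) U j) x κ ∈ U1 𝔸)
  (hregU : ∀ (j : ℕ) (y : TSite d (towerP L m j)) (κ : Fin d) (r : Fin d → Fin L),
    ‖((Wcx L (perCfg (towerP L m (j + 1)) (B9Eq315QTower.UlevOf L m (n + 1) U j)) (cornerSite L y) κ (boxVec L r) : 𝔸ˣ) : 𝔸) - 1‖ ≤ α j)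
  (hU1V : ∀ (j : ℕ) (x : B7Prop1Explicit.Site d) (κ : Fin d), perCfg (towerP L m (j + 1)) (B9Eq315QTower.UlevOf L m (n + 1) V j) x κ ∈ U1 𝔸)
  (hregV : ∀ (j : ℕ) (y : TSite d (towerP L m j)) (κ : Fin d) (r : Fin d → Fin L),
    ‖((Wcx L (perCfg (towerP L m (j + 1)) (B9Eq315QTower.UlevOf L m (n + 1) V j)) (cornerSite L y) κ (boxVec L r) : 𝔸ˣ) : 𝔸) - 1‖ ≤ α j)
  (a : ℝ)

include hφ hφ' hMφ hMφ' hη hηL hU hV hRSU hRSV in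
/-- **THE BIG-BLOCK `L²` DECAY OF `G₁,k(V) − G₁,k(U)`, EVERY HEIGHT `n`**: on the tower at the diagonal `ηL^{n+1} = 1`, for two backgrounds of the model
class at bond closeness `‖U(b) − V(b)‖ ≤ δη`, given (CDT)'s displayed letters at both backgrounds (`γ`, `p_K`, `C_P`, the radius windows with `1 ≤ ℓ`, the
energy window `¾p_K + … ≤ γ∕8`, and the conjugated `Q_k` ∕ `Δ′` ∕ `R_k` letters UNIFORMLY over the weights and the circle — two `hQK` bundles), the
conjugated two-background sockets `δ_R, δ_Q, δ_K` uniformly (`hT2`) and the Lipschitz letters `e_R, e_Q`: for every bond big-block family `P` and every pair of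
unit-lattice sites, `‖P_{y₁} ∘ (G₁,k(V) − G₁,k(U)) ∘ P_{y₀}‖ ≤ C(δ)·e^{r}·e^{−r·d_m(y₀,y₁)}` with `C(δ)` §1's constant — (GBDT) §2's read-out on §1.
[folklore] [cite: Balaban1985BackgroundPropagators, (3.26) p.395, Thm 3.4 p.400, (3.86) p.407, Thm 3.11 p.416, (3.49) p.399; Balaban1985Variational, (110) p.294] -/
theorem norm_block_G1k_sub_G1k_le (ha : 0 ≤ a) (hm : ∀ i, 1 ≤ m i)
    (hposU : ∀ x : BondL2K ℂ d (towerP L m (n + 1)) c₀ W, x ≠ 0 → 0 < RCLike.re ⟪x, laplaceAk L m n φ η U hL α hα1 hU1U hregU τ (c₀ := c₀) (c₁ := c₁) a x⟫_ℂ)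
    (hposV : ∀ x : BondL2K ℂ d (towerP L m (n + 1)) c₀ W, x ≠ 0 → 0 < RCLike.re ⟪x, laplaceAk L m n φ η V hL α hα1 hU1V hregV τ (c₀ := c₀) (c₁ := c₁) a x⟫_ℂ)
    {γ β βK pK ℓ ℓ' r ρ CP : ℝ} (hγ : 0 < γ) (hβ : 0 ≤ β) (hℓ : 1 ≤ ℓ) (hℓ' : 1 ≤ ℓ') (hr : 0 ≤ r) (hρ : 0 ≤ ρ) (hρ8 : ρ ≤ 1 / 8)
    (hCP : 0 ≤ CP)
    (hcoerU : ∀ f : BondL2K ℂ d (towerP L m (n + 1)) c₀ W, γ * ‖f‖ ^ 2 ≤ RCLike.re ⟪f, laplaceAk L m n φ η U hL α hα1 hU1U hregU τ (c₀ := c₀) (c₁ := c₁) a f⟫_ℂ)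
    (hcoerV : ∀ f : BondL2K ℂ d (towerP L m (n + 1)) c₀ W, γ * ‖f‖ ^ 2 ≤ RCLike.re ⟪f, laplaceAk L m n φ η V hL α hα1 hU1V hregV τ (c₀ := c₀) (c₁ := c₁) a f⟫_ℂ)
    (hKreU : ∀ f : BondL2K ℂ d (towerP L m (n + 1)) c₀ W, -(pK * ‖f‖ ^ 2) ≤ RCLike.re ⟪f, curvOp φ τ η U f⟫_ℂ)
    (hKreV : ∀ f : BondL2K ℂ d (towerP L m (n + 1)) c₀ W, -(pK * ‖f‖ ^ 2) ≤ RCLike.re ⟪f, curvOp φ τ η V f⟫_ℂ)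
    (hwin : r * ℓ * η ≤ 1)
    (hβCC : 4 * r * ℓ * (Mφ * Mφ') * (d * Real.sqrt d) ≤ β) (hβC : 4 * r * ℓ * (Mφ * Mφ') * d ≤ β)
    (hβD : 2 * r * ℓ * (Mφ * Mφ') * Real.sqrt d ≤ β)
    (hQKU : ∀ (χ : TSite d (towerP L m (n + 1)) → ℝ) (χ' : TSite d m → ℝ),
      (∀ b : Bond d (towerP L m (n + 1)), |χ (bpos b) - χ (btgt b)| ≤ ℓ * η) →
      (∀ (y : TSite d m) (x : TSite d (towerP L m (n + 1))),
        siteCast (towerP_eq_fineP_pow L m (n + 1)) x ∈ B9Eq319QprimeTorus.blockOf (L ^ (n + 1)) m y → |χ' y - χ x| ≤ ℓ') →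
      ∀ (MB : BondL2K ℂ d (towerP L m (n + 1)) c₀ W →L[ℂ] BondL2K ℂ d (towerP L m (n + 1)) c₀ W),
      (∀ (g : BondL2K ℂ d (towerP L m (n + 1)) c₀ W) (b : Bond d (towerP L m (n + 1))),
        WL2.equiv ℂ (fun _ : Bond d (towerP L m (n + 1)) => c₀) W (MB g) b = (χ (bpos b) : ℂ) • WL2.equiv ℂ (fun _ : Bond d (towerP L m (n + 1)) => c₀) W g b) →
      ∀ (MS : SiteL2K ℂ d (towerP L m (n + 1)) c₀ W →L[ℂ] SiteL2K ℂ d (towerP L m (n + 1)) c₀ W),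
      (∀ (g : SiteL2K ℂ d (towerP L m (n + 1)) c₀ W) (x : TSite d (towerP L m (n + 1))),
        WL2.equiv ℂ (fun _ : TSite d (towerP L m (n + 1)) => c₀) W (MS g) x = (χ x : ℂ) • WL2.equiv ℂ (fun _ : TSite d (towerP L m (n + 1)) => c₀) W g x) →
      ∀ (MF : BondL2K ℂ d m c₁ W →L[ℂ] BondL2K ℂ d m c₁ W),
      (∀ (g : BondL2K ℂ d m c₁ W) (b' : Bond d m),
        WL2.equiv ℂ (fun _ : Bond d m => c₁) W (MF g) b' = (χ' (bpos b') : ℂ) • WL2.equiv ℂ (fun _ : Bond d m => c₁) W g b') →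
      ∀ κ : ℂ, ‖κ‖ = r →
      (∀ f, ‖exp (κ • MF) ((QkW L m n φ U hL α hα1 hU1U hregU (c₀ := c₀) (c₁ := c₁)) (exp (κ • (-MB)) f)) - (QkW L m n φ U hL α hα1 hU1U hregU (c₀ := c₀) (c₁ := c₁)) f‖ ≤ β * ‖f‖) ∧
      (∀ g, ‖exp (κ • MB) (LinearMap.adjoint (QkW L m n φ U hL α hα1 hU1U hregU (c₀ := c₀) (c₁ := c₁)) (exp (κ • (-MF)) g)) - LinearMap.adjoint (QkW L m n φ U hL α hα1 hU1U hregU (c₀ := c₀) (c₁ := c₁)) g‖ ≤ β * ‖g‖) ∧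
      (∀ f, ‖exp (κ • MB) (curvOp φ τ η U (exp (κ • (-MB)) f)) - curvOp φ τ η U f‖ ≤ βK * ‖f‖) ∧
      (∀ s, ‖exp (κ • MS) (RofUk L m n φ η U (c₀ := c₀) (exp (κ • (-MS)) s)) - RofUk L m n φ η U (c₀ := c₀) s‖ ≤ ρ * ‖s‖))
    (hQKV : ∀ (χ : TSite d (towerP L m (n + 1)) → ℝ) (χ' : TSite d m → ℝ),
      (∀ b : Bond d (towerP L m (n + 1)), |χ (bpos b) - χ (btgt b)| ≤ ℓ * η) →
      (∀ (y : TSite d m) (x : TSite d (towerP L m (n + 1))),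
        siteCast (towerP_eq_fineP_pow L m (n + 1)) x ∈ B9Eq319QprimeTorus.blockOf (L ^ (n + 1)) m y → |χ' y - χ x| ≤ ℓ') →
      ∀ (MB : BondL2K ℂ d (towerP L m (n + 1)) c₀ W →L[ℂ] BondL2K ℂ d (towerP L m (n + 1)) c₀ W),
      (∀ (g : BondL2K ℂ d (towerP L m (n + 1)) c₀ W) (b : Bond d (towerP L m (n + 1))),
        WL2.equiv ℂ (fun _ : Bond d (towerP L m (n + 1)) => c₀) W (MB g) b = (χ (bpos b) : ℂ) • WL2.equiv ℂ (fun _ : Bond d (towerP L m (n + 1)) => c₀) W g b) →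
      ∀ (MS : SiteL2K ℂ d (towerP L m (n + 1)) c₀ W →L[ℂ] SiteL2K ℂ d (towerP L m (n + 1)) c₀ W),
      (∀ (g : SiteL2K ℂ d (towerP L m (n + 1)) c₀ W) (x : TSite d (towerP L m (n + 1))),
        WL2.equiv ℂ (fun _ : TSite d (towerP L m (n + 1)) => c₀) W (MS g) x = (χ x : ℂ) • WL2.equiv ℂ (fun _ : TSite d (towerP L m (n + 1)) => c₀) W g x) →
      ∀ (MF : BondL2K ℂ d m c₁ W →L[ℂ] BondL2K ℂ d m c₁ W),
      (∀ (g : BondL2K ℂ d m c₁ W) (b' : Bond d m),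
        WL2.equiv ℂ (fun _ : Bond d m => c₁) W (MF g) b' = (χ' (bpos b') : ℂ) • WL2.equiv ℂ (fun _ : Bond d m => c₁) W g b') →
      ∀ κ : ℂ, ‖κ‖ = r →
      (∀ f, ‖exp (κ • MF) ((QkW L m n φ V hL α hα1 hU1V hregV (c₀ := c₀) (c₁ := c₁)) (exp (κ • (-MB)) f)) - (QkW L m n φ V hL α hα1 hU1V hregV (c₀ := c₀) (c₁ := c₁)) f‖ ≤ β * ‖f‖) ∧
      (∀ g, ‖exp (κ • MB) (LinearMap.adjoint (QkW L m n φ V hL α hα1 hU1V hregV (c₀ := c₀) (c₁ := c₁)) (exp (κ • (-MF)) g)) - LinearMap.adjoint (QkW L m n φ V hL α hα1 hU1V hregV (c₀ := c₀) (c₁ := c₁)) g‖ ≤ β * ‖g‖) ∧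
      (∀ f, ‖exp (κ • MB) (curvOp φ τ η V (exp (κ • (-MB)) f)) - curvOp φ τ η V f‖ ≤ βK * ‖f‖) ∧
      (∀ s, ‖exp (κ • MS) (RofUk L m n φ η V (c₀ := c₀) (exp (κ • (-MS)) s)) - RofUk L m n φ η V (c₀ := c₀) s‖ ≤ ρ * ‖s‖))
    (hPU : ∀ f, ‖covDivL2K ℂ c₀ ((η : ℂ))⁻¹ (adTransportW φ fun b => (U b)⁻¹) f - RofUk L m n φ η U (c₀ := c₀) (covDivL2K ℂ c₀ ((η : ℂ))⁻¹ (adTransportW φ fun b => (U b)⁻¹) f)‖ ≤ CP * ‖f‖)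
    (hPV : ∀ f, ‖covDivL2K ℂ c₀ ((η : ℂ))⁻¹ (adTransportW φ fun b => (V b)⁻¹) f - RofUk L m n φ η V (c₀ := c₀) (covDivL2K ℂ c₀ ((η : ℂ))⁻¹ (adTransportW φ fun b => (V b)⁻¹) f)‖ ≤ CP * ‖f‖)
    (small' : 3 / 4 * pK + (21 + 3 * a) * β ^ 2 + 4 * β * CP + 2 * ρ * CP ^ 2 + βK ≤ γ / 8)
    {δR δQ δK : ℝ} (hδR : 0 ≤ δR) (hδQ : 0 ≤ δQ) (hδK : 0 ≤ δK)
    (hT2 : ∀ (χ : TSite d (towerP L m (n + 1)) → ℝ) (χ' : TSite d m → ℝ),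
      (∀ b : Bond d (towerP L m (n + 1)), |χ (bpos b) - χ (btgt b)| ≤ ℓ * η) →
      (∀ (y : TSite d m) (x : TSite d (towerP L m (n + 1))),
        siteCast (towerP_eq_fineP_pow L m (n + 1)) x ∈ B9Eq319QprimeTorus.blockOf (L ^ (n + 1)) m y → |χ' y - χ x| ≤ ℓ') →
      ∀ (MB : BondL2K ℂ d (towerP L m (n + 1)) c₀ W →L[ℂ] BondL2K ℂ d (towerP L m (n + 1)) c₀ W),
      (∀ (g : BondL2K ℂ d (towerP L m (n + 1)) c₀ W) (b : Bond d (towerP L m (n + 1))),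
        WL2.equiv ℂ (fun _ : Bond d (towerP L m (n + 1)) => c₀) W (MB g) b = (χ (bpos b) : ℂ) • WL2.equiv ℂ (fun _ : Bond d (towerP L m (n + 1)) => c₀) W g b) →
      ∀ (MS : SiteL2K ℂ d (towerP L m (n + 1)) c₀ W →L[ℂ] SiteL2K ℂ d (towerP L m (n + 1)) c₀ W),
      (∀ (g : SiteL2K ℂ d (towerP L m (n + 1)) c₀ W) (x : TSite d (towerP L m (n + 1))),
        WL2.equiv ℂ (fun _ : TSite d (towerP L m (n + 1)) => c₀) W (MS g) x = (χ x : ℂ) • WL2.equiv ℂ (fun _ : TSite d (towerP L m (n + 1)) => c₀) W g x) →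
      ∀ (MF : BondL2K ℂ d m c₁ W →L[ℂ] BondL2K ℂ d m c₁ W),
      (∀ (g : BondL2K ℂ d m c₁ W) (b' : Bond d m),
        WL2.equiv ℂ (fun _ : Bond d m => c₁) W (MF g) b' = (χ' (bpos b') : ℂ) • WL2.equiv ℂ (fun _ : Bond d m => c₁) W g b') →
      ∀ κ : ℂ, ‖κ‖ = r →
      (∀ s, ‖exp (κ • MS) (RofUk L m n φ η V (c₀ := c₀) (exp (κ • (-MS)) s)) - exp (κ • MS) (RofUk L m n φ η U (c₀ := c₀) (exp (κ • (-MS)) s))‖ ≤ δR * ‖s‖) ∧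
      (∀ f, ‖exp (κ • MF) ((QkW L m n φ V hL α hα1 hU1V hregV (c₀ := c₀) (c₁ := c₁)) (exp (κ • (-MB)) f)) - exp (κ • MF) ((QkW L m n φ U hL α hα1 hU1U hregU (c₀ := c₀) (c₁ := c₁)) (exp (κ • (-MB)) f))‖ ≤ δQ * ‖f‖) ∧
      (∀ g, ‖exp (κ • MB) (LinearMap.adjoint (QkW L m n φ V hL α hα1 hU1V hregV (c₀ := c₀) (c₁ := c₁)) (exp (κ • (-MF)) g)) - exp (κ • MB) (LinearMap.adjoint (QkW L m n φ U hL α hα1 hU1U hregU (c₀ := c₀) (c₁ := c₁)) (exp (κ • (-MF)) g))‖ ≤ δQ * ‖g‖) ∧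
      (∀ f, ‖exp (κ • MB) (curvOp φ τ η V (exp (κ • (-MB)) f)) - exp (κ • MB) (curvOp φ τ η U (exp (κ • (-MB)) f))‖ ≤ δK * ‖f‖))
    {δ eR eQ : ℝ} (hδ : 0 ≤ δ) (heR : 0 ≤ eR) (heQ : 0 ≤ eQ) (hUV : ∀ b, ‖(U b : 𝔸) - (V b : 𝔸)‖ ≤ δ * η)
    (uR : ∀ s, ‖RofUk L m n φ η U (c₀ := c₀) s - RofUk L m n φ η V (c₀ := c₀) s‖ ≤ eR * ‖s‖) (uQ : ∀ f, ‖(QkW L m n φ U hL α hα1 hU1U hregU (c₀ := c₀) (c₁ := c₁)) f - (QkW L m n φ V hL α hα1 hU1V hregV (c₀ := c₀) (c₁ := c₁)) f‖ ≤ eQ * ‖f‖)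
    (PB : TSite d m → BondL2K ℂ d (towerP L m (n + 1)) c₀ W →L[ℂ] BondL2K ℂ d (towerP L m (n + 1)) c₀ W)
    (hPB : ∀ (y : TSite d m) (f : BondL2K ℂ d (towerP L m (n + 1)) c₀ W) (b : Bond d (towerP L m (n + 1))),
      WL2.equiv ℂ (fun _ : Bond d (towerP L m (n + 1)) => c₀) W (PB y f) b =
        if blockCoord (L ^ (n + 1)) m (siteCast (towerP_eq_fineP_pow L m (n + 1)) (bpos b)) = y then
          WL2.equiv ℂ (fun _ : Bond d (towerP L m (n + 1)) => c₀) W f b else 0)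
    (y₀ y₁ : TSite d m) :
    ‖PB y₁ ∘L (LinearMap.toContinuousLinearMap (G1k L m n φ η V hL α hα1 hU1V hregV τ (c₀ := c₀) (c₁ := c₁) hposV) - LinearMap.toContinuousLinearMap (G1k L m n φ η U hL α hα1 hU1U hregU τ (c₀ := c₀) (c₁ := c₁) hposU)) ∘L PB y₀‖ ≤
      (((1 + β) * (4 * Real.exp (r * (ℓ * η)) * (Mφ * Mφ') * (d * Real.sqrt d) * δ) + (4 * Real.exp (r * (ℓ * η)) * (Mφ * Mφ') * (d * Real.sqrt d) * δ) * (1 + β) + (4 * Real.exp (r * (ℓ * η)) * (Mφ * Mφ') * (d * Real.sqrt d) * δ) * (4 * Real.exp (r * (ℓ * η)) * (Mφ * Mφ') * (d * Real.sqrt d) * δ)) +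
          ((1 + CP + β) * ((1 + ρ) * (2 * Real.exp (r * (ℓ * η)) * (Mφ * Mφ') * Real.sqrt d * δ) + δR * (1 + CP + β)) + (2 * Real.exp (r * (ℓ * η)) * (Mφ * Mφ') * Real.sqrt d * δ) * ((1 + ρ) * (1 + CP + β)) +
            (2 * Real.exp (r * (ℓ * η)) * (Mφ * Mφ') * Real.sqrt d * δ) * ((1 + ρ) * (2 * Real.exp (r * (ℓ * η)) * (Mφ * Mφ') * Real.sqrt d * δ) + δR * (1 + CP + β))) +
          δK + ((Real.sqrt a + |a| * β) * δQ + δQ * (Real.sqrt a + |a| * β) + |a| * (δQ * δQ))) / min (1 / 4) (γ / 8) *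
        ((1 + (8 * Real.sqrt d * (Mφ * Mφ') * δ + 2 * Mφ * Mφ' * δ * Real.sqrt d + eR * (1 + CP) + Real.sqrt a * eQ)) * (min (1 / 4) (γ / 8))⁻¹) * Real.exp r * Real.exp (-(r * tdist m y₀ y₁)) := by
  have hL0 : (0 : ℝ) < L := by exact_mod_cast Nat.pos_of_ne_zero (NeZero.ne L)
  have hLp : (0 : ℝ) < (L : ℝ) ^ (n + 1) := pow_pos hL0 _
  have hι : 1 / ((L ^ (n + 1) : ℕ) : ℝ) ≤ ℓ * η := by
    rw [Nat.cast_pow, div_le_iff₀ hLp]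
    calc (1 : ℝ) = 1 * (η * (L : ℝ) ^ (n + 1)) := by rw [hηL, mul_one]
      _ ≤ ℓ * (η * (L : ℝ) ^ (n + 1)) := by gcongr
      _ = ℓ * η * (L : ℝ) ^ (n + 1) := by ring
  refine norm_bondBlock_le_exp_of_uniform_circle_bound_cast m (towerP_eq_fineP_pow L m (n + 1)) hm _ hPB hr (by positivity) hι hℓ'
    (fun χ χ' hχ hχ' MB hMB κ hκr => ?_) y₀ y₁
  obtain ⟨MP, hMP⟩ := exists_pointwise_clm (𝕜 := ℂ) (w := fun _ : B9SectCLatticeCarrier.Plaq d (towerP L m (n + 1)) => c₀) (V := W)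
    (fun p : B9SectCLatticeCarrier.Plaq d (towerP L m (n + 1)) => p.1) χ
  obtain ⟨MS, hMS⟩ := exists_pointwise_clm (𝕜 := ℂ) (w := fun _ : TSite d (towerP L m (n + 1)) => c₀) (V := W)
    (fun x : TSite d (towerP L m (n + 1)) => x) χ
  obtain ⟨MF, hMF⟩ := exists_pointwise_clm (𝕜 := ℂ) (w := fun _ : Bond d m => c₁) (V := W) (fun b' : Bond d m => bpos b') (fun y => χ' y)
  obtain ⟨dQU, dQU', dKU, dRU⟩ := hQKU χ χ' hχ hχ' MB hMB MS hMS MF hMF κ hκr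
  obtain ⟨dQV, dQV', dKV, dRV⟩ := hQKV χ χ' hχ hχ' MB hMB MS hMS MF hMF κ hκr
  obtain ⟨tR, tQ, tQ', tK⟩ := hT2 χ χ' hχ hχ' MB hMB MS hMS MF hMF κ hκr
  exact norm_conjG1k_sub_conjG1k_le_of_circle L m n φ hφ hφ' hMφ hMφ' hη U V hU hV hRSU hRSV τ hL α hα1 hU1U hregU hU1V hregV a hMB hMP hMS hMF ha hposU
    hposV hγ hβ (zero_le_one.trans hℓ) hρ hρ8 hCP hcoerU hcoerV hKreU hKreV hχ hwin hβCC hβC hβD hPU hPV small' κ hκr dQU dQU' dKU dRU dQV dQV' dKV dRV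
    hδR hδQ hδK tR tQ tQ' tK hδ heR heQ hUV uR uQ

end Instance

end Literature.MathematicalPhysics.QuantumFieldTheory.Balaban1983to89.B9Eq326DeltaABlockDecayTowerTwoBackgrounds

end
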